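/-
Copyright (c) 2026. All rights reserved.
Released under Apache 2.0 license as described in the file LICENSE.
-/
import Literature.Geometry.Kaehler.ComplexTorusQuaternionXSixSpecialPointsFibres
import Literature.Geometry.Kaehler.ComplexTorusQuaternionXSixPlusEllipticPoints
import Literature.Geometry.Kaehler.ComplexTorusQuaternionXSixEllipticElements
import Literature.Geometry.Kaehler.ComplexTorusQuaternionXSixSpecialPointsDictionary
import HarnessLib

/-!
# `Z(t)` through the elliptic points of `X₆` and of `X₆⁺`: `Z(t)` meets an elliptic point of `X₆` iff
# `t ∈ ℤ² ∪ 3ℤ²`, an elliptic point of `X₆⁺` iff `t ∈ ℤ² ∪ 3ℤ² ∪ 6ℤ²` (`t > 0`), and the two-class fibres of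
# `X₆ → X₆⁺` on `Z(t)` are exactly the fibres over the elliptic points of `X₆⁺`

[tag: complex_torus] [tag: abelian_surface] [tag: quaternion_multiplication] [tag: complex_multiplication]
[tag: shimura_curve] [tag: special_cycles] [tag: atkin_lehner] [tag: elliptic_points]

Lane `lit-hodgefound`, seat p12, row g37-#4 — THEOREMS ONLY (no definition, no named fact, no instance). Setting as in all
`…XSix…` files: `B = (−1,3)_ℚ`, `𝔬 = ℤ⟨1, i, j, ij⟩`, the maximal order `O₆` as the predicate `a ∈ 𝔬 ∨ a − e ∈ 𝔬`,
`Γ₆ = O₆¹`, `ρ = rho (-1) 3`, `Pt(t) = {τ ∈ ℌ : ρ(x)τ = τ for some x ∈ 𝔬, tr x = 0, nr x = t}`,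
`Γ₆⁺ = N(O₆)⁺ = {g ≠ 0 : gO₆ ⊆ O₆g, nr g > 0}`. An ELLIPTIC point of `X₆ = Γ₆∖ℌ` is (the class of) a `τ ∈ ℌ` fixed by
some `u ∈ Γ₆`, `u ≠ ±1`; an elliptic point of `X₆⁺ = Γ₆⁺∖ℌ` is a `τ` fixed by some NON-SCALAR `g ∈ Γ₆⁺` (scalars act
trivially). The tree knows the elliptic points element-wise: g31-#2 `…XSixEllipticElements` (an elliptic `u ∈ Γ₆` is a
special vector of norm `1` or `±(1 + x)/2` with `x ∈ L(3)` — orders `2`, `3`; the points `P₆, P₁₃₅, P₂, P₄`), g33-#8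
`…XSixPlusEllipticPoints` (a non-scalar `g ∈ Γ₆⁺` fixing `τ` puts `τ` on `Z(1) ∪ Z(3) ∪ Z(6)` — the vertices `P₆, P₄, P₀`
of `t₆⁺`, isotropy `4, 6, 2`), and g37-#2 `…XSixSpecialPointsFibres` (a fibre of `Pt(t)/Γ₆ → Pt(t)/Γ₆⁺` has `2` classes
iff it consists of `Z(1)`-, `Z(3)`- or `Z(6)`-points, else `4`). This file states the consequences for the special
cycles `Z(t)`.

## The mechanism (the print)

Two special vectors at one CM point are proportional (KRY Prop. 3.4.1: «any nonscalar `x ∈ End(A, ι) ⊗ ℚ` generates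
an imaginary quadratic field»), so `Z(t) ∩ Z(t₀) ≠ ∅` iff `t = m²t₀` ((3.4.6) «`4t = n²d`»); the elliptic points of
`X₆` are the `Z(1)`- and `Z(3)`-points (Vignéras IV §3 A: `e₂ = e₃ = 2` for `D = 6`; Bayer–Travesa Thm. 1.1: `P₆,
P₁₃₅` of order `2`, `P₂, P₄` of order `3`), those of `X₆⁺` the `Z(1)`-, `Z(3)`-, `Z(6)`-points (Ogg §2: the fixed
points of `w(m)` have `μ² = −m`, or `ε = 1 + ζ₄` (`m = 2`), `ε = 1 − ζ₃` (`m = 3`); Bayer–Travesa §7 Table 9: `e = 4,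
6, 2`); and the stabiliser in `W = Γ₆⁺/ℚ^×Γ₆ ≅ (ℤ/2ℤ)²` of a `Γ₆`-class `[τ]` is non-trivial iff `τ` is fixed by a
non-scalar element of `Γ₆⁺ ∖ ℚ^×Γ₆` up to `Γ₆` — i.e. iff `τ` is elliptic on `X₆⁺` (KRY Remark 3.4.7: «the group of
Atkin-Lehner involutions permutes the components transitively»).

* S. Kudla, M. Rapoport, T. Yang (2006), §3.4: Prop. 3.4.1, (3.4.6), (3.4.9), Remark 3.4.7. [cite: KudlaRapoportYang2006, §3.4]
* A. P. Ogg (1983), §2 pp. 283–284, (2)–(4). [cite: Ogg1983RealPoints, §2]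
* P. Bayer, A. Travesa (2007), §1 Thm. 1.1, §2, §7 Table 9. [cite: BayerTravesa2007, §1–§2 and §7]
* M.-F. Vignéras (1980), Ch. IV §3 A–B. [cite: VignerasLNM800, Ch. IV §3 A–B]

## What is proved

* §1 (`t > 0`) **`exists_specialPoint_mem_one_iff`**, **`exists_specialPoint_mem_three_iff`**,
  **`exists_specialPoint_mem_six_iff`**: `Z(t)` passes through the `Z(1)`-, `Z(3)`-, `Z(6)`-points iff `t ∈ ℤ²`,
  `3ℤ²`, `6ℤ²`.
* §2 `X₆`: **`elliptic_iff_mem_one_or_three`** (a point of `Pt(t)` is elliptic for `Γ₆` iff it lies on `Z(1) ∪ Z(3)`),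
  **`exists_specialPoint_elliptic_iff`** (`Z(t)` passes through an elliptic point of `X₆` iff `t ∈ ℤ² ∪ 3ℤ²`, `t > 0`),
  **`card_fibre_eq_two_of_elliptic`** (the `W`-orbit of an elliptic point of `X₆` on `Z(t)` is short).
* §3 `X₆⁺`: **`plusElliptic_iff_mem_one_three_six`** (a point of `Pt(t)` is elliptic for `Γ₆⁺` iff it lies on
  `Z(1) ∪ Z(3) ∪ Z(6)`), **`exists_specialPoint_plusElliptic_iff`** (`Z(t)` passes through an elliptic point of `X₆⁺`
  iff `t ∈ ℤ² ∪ 3ℤ² ∪ 6ℤ²`, `t > 0`), **`card_fibre_eq_two_iff_plusElliptic`** (a fibre of `X₆ → X₆⁺` on `Z(t)` has two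
  classes iff it lies over an elliptic point of `X₆⁺`), **`card_fibre_eq_four_iff_not_plusElliptic`**.

## Honest scope

A synthesis row over g31-#2, g33-#4/#8, g35-#10, g36-#2 and g37-#2: no new arithmetic of `B`; "elliptic point" is the
element-wise condition displayed in each statement (no orbifold structure on a quotient is constructed, isotropy ORDERS
are not restated here — see `…XSixPlusStabilisers`). 0 definitions, 0 named facts, 0 instances — net debt `0`.
-/

noncomputable section

set_option maxSynthPendingDepth 3

open Quaternion Function

namespace Literature.Geometry.Kaehler.ComplexTorus.QuaternionType

/-! ## §0 Helpers -/

section Helpers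

/-- A point of `Pt(t₀)` from `#(Pt(t₀)/Γ₆) ≠ 0`. [folklore] -/
private theorem exists_point₁₉ (t₀ : ℤ) (h : Nat.card (Quot (fun p q : {τ : ℂ // 0 < τ.im ∧ ∃ x : ℍ[ℚ,((-1 : ℤ) : ℚ),((3 : ℤ) : ℚ)],
        x ∈ order (-1) 3 ∧ x.re = 0 ∧ (x * star x).re = t₀ ∧ moebius (rho (-1) 3 (by norm_num) (castQ (-1) 3 x)) τ = τ} ↦
      ∃ v : ℍ[ℚ,((-1 : ℤ) : ℚ),((3 : ℤ) : ℚ)], (v ∈ order (-1) 3 ∨ v - ⟨1/2, 1/2, 1/2, -1/2⟩ ∈ order (-1) 3) ∧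
        v * star v = 1 ∧ moebius (rho (-1) 3 (by norm_num) (castQ (-1) 3 v)) p.1 = q.1)) ≠ 0) :
    ∃ τ : ℂ, 0 < τ.im ∧ ∃ x : ℍ[ℚ,((-1 : ℤ) : ℚ),((3 : ℤ) : ℚ)], x ∈ order (-1) 3 ∧ x.re = 0 ∧ (x * star x).re = t₀ ∧
        moebius (rho (-1) 3 (by norm_num) (castQ (-1) 3 x)) τ = τ := by
  obtain ⟨c⟩ := (Nat.card_ne_zero.1 h).1
  induction c using Quot.ind with
  | _ p => exact ⟨p.1, p.2.1, p.2.2⟩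

/-- `Pt(t₀) ⊆ Pt(m²t₀)`: a point of `Pt(t₀)` is a point of `Pt(t)` for `t = m²t₀`, `m ≠ 0`. [folklore] -/
private theorem mem_of_sq_mul₁₉ {t t₀ m : ℤ} (hm : m ≠ 0) (htm : t = m ^ 2 * t₀) {τ : ℂ}
    (hy : ∃ x : ℍ[ℚ,((-1 : ℤ) : ℚ),((3 : ℤ) : ℚ)], x ∈ order (-1) 3 ∧ x.re = 0 ∧ (x * star x).re = t₀ ∧
        moebius (rho (-1) 3 (by norm_num) (castQ (-1) 3 x)) τ = τ) :
    ∃ x : ℍ[ℚ,((-1 : ℤ) : ℚ),((3 : ℤ) : ℚ)], x ∈ order (-1) 3 ∧ x.re = 0 ∧ (x * star x).re = t ∧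
        moebius (rho (-1) 3 (by norm_num) (castQ (-1) 3 x)) τ = τ := by
  have hx := specialPoints_mono_sq_mul (t₀ := t₀) hm (τ := τ) hy
  rw [← htm] at hx
  exact hx

/-- **A special vector of norm `1`, `3` or `6` is a non-scalar element of `Γ₆⁺`** (an element of `O₆` of norm dividing
`6` normalises `O₆`: `exists_unit_mul_atkinLehner_of_norm_dvd_six` + `normalises_of_eq_smul_unit_mul_atkinLehner`).
[cite: BayerTravesa2007, §2 p. 318] [cite: Ogg1983RealPoints, §2 p. 283] -/
private theorem plusElliptic_of_special₁₉ {τ : ℂ} {y : ℍ[ℚ,((-1 : ℤ) : ℚ),((3 : ℤ) : ℚ)]} {t₀ : ℤ} (ht₀ : t₀ = 1 ∨ t₀ = 3 ∨ t₀ = 6)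
    (hy : y ∈ order (-1) 3) (hre : y.re = 0) (hyn : (y * star y).re = t₀)
    (hfix : moebius (rho (-1) 3 (by norm_num) (castQ (-1) 3 y)) τ = τ) :
    ∃ g : ℍ[ℚ,((-1 : ℤ) : ℚ),((3 : ℤ) : ℚ)], g ≠ 0 ∧
        (∀ a : ℍ[ℚ,((-1 : ℤ) : ℚ),((3 : ℤ) : ℚ)], (a ∈ order (-1) 3 ∨ a - ⟨1/2, 1/2, 1/2, -1/2⟩ ∈ order (-1) 3) →
          ∃ b : ℍ[ℚ,((-1 : ℤ) : ℚ),((3 : ℤ) : ℚ)], (b ∈ order (-1) 3 ∨ b - ⟨1/2, 1/2, 1/2, -1/2⟩ ∈ order (-1) 3) ∧ g * a = b * g) ∧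
        0 < (g * star g).re ∧ (∀ q : ℚ, g ≠ (q : ℍ[ℚ,((-1 : ℤ) : ℚ),((3 : ℤ) : ℚ)])) ∧
        moebius (rho (-1) 3 (by norm_num) (castQ (-1) 3 g)) τ = τ := by
  have hd : t₀ ∣ 6 := by rcases ht₀ with rfl | rfl | rfl <;> norm_num
  have hpos : (0 : ℚ) < t₀ := by rcases ht₀ with rfl | rfl | rfl <;> norm_num
  obtain ⟨v, k, l, hv, h1, -, -, hyeq⟩ := exists_unit_mul_atkinLehner_of_norm_dvd_six (Or.inl hy) hd hyn
  have hN := normalises_of_eq_smul_unit_mul_atkinLehner (g := y) (q := 1) hv h1 k l (by rw [one_smul]; exact hyeq)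
  refine ⟨y, ?_, hN.2.1, by rw [hyn]; exact hpos, ?_, hfix⟩
  · intro h0
    rw [h0, zero_mul, QuaternionAlgebra.re_zero] at hyn
    rw [← hyn] at hpos
    exact lt_irrefl _ hpos
  · intro q hq
    have hre' := congrArg QuaternionAlgebra.re hq
    rw [hre, QuaternionAlgebra.re_coe] at hre'
    rw [← hre', QuaternionAlgebra.coe_zero] at hq
    rw [hq, zero_mul, QuaternionAlgebra.re_zero] at hyn
    rw [← hyn] at hpos
    exact lt_irrefl _ hpos

end Helpers

/-! ## §1 When does `Z(t)` pass through the `Z(1)`-, `Z(3)`-, `Z(6)`-points? -/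

section Through

/-- **`Z(t)` PASSES THROUGH THE `Z(1)`-POINTS IFF `t ∈ ℤ²`** (`t > 0`): `Pt(t) ∩ Pt(1) ≠ ∅ ⟺ t = m ^ 2` —
commensurability one way, `Pt(1) ⊆ Pt(m²·1)` and `Pt(1) ≠ ∅` (`#(Pt(1)/Γ₆) = 2`) the other. [cite: KudlaRapoportYang2006, §3.4 Prop. 3.4.1, (3.4.6) and (3.4.9)] [cite: Ogg1983RealPoints, §2 (4)] [cite: BayerTravesa2007, §1 Thm. 1.1] -/
theorem exists_specialPoint_mem_one_iff {t : ℤ} (ht : 0 < t) :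
    (∃ τ : ℂ, 0 < τ.im ∧ (∃ x : ℍ[ℚ,((-1 : ℤ) : ℚ),((3 : ℤ) : ℚ)], x ∈ order (-1) 3 ∧ x.re = 0 ∧ (x * star x).re = t ∧
        moebius (rho (-1) 3 (by norm_num) (castQ (-1) 3 x)) τ = τ) ∧
      (∃ y : ℍ[ℚ,((-1 : ℤ) : ℚ),((3 : ℤ) : ℚ)], y ∈ order (-1) 3 ∧ y.re = 0 ∧ (y * star y).re = 1 ∧
        moebius (rho (-1) 3 (by norm_num) (castQ (-1) 3 y)) τ = τ)) ↔
    ∃ m : ℤ, t = m ^ 2 := by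
  constructor
  · rintro ⟨τ, hτ, ⟨x, -, hxre, hxn, hfx⟩, ⟨y, -, hyre, hyn, hfy⟩⟩
    exact exists_eq_sq_of_specialPoints_inter_one hτ.ne' hxre hyre hxn hyn hfx hfy
  · rintro ⟨m, hm⟩
    have hm0 : m ≠ 0 := by rintro rfl; rw [hm] at ht; norm_num at ht
    obtain ⟨τ, hτ, hy⟩ := exists_point₁₉ 1 (by rw [card_specialPoints_table.1]; norm_num)
    exact ⟨τ, hτ, mem_of_sq_mul₁₉ hm0 (by rw [hm, mul_one]) hy, by push_cast at hy; exact hy⟩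

/-- **`Z(t)` PASSES THROUGH THE `Z(3)`-POINTS IFF `t ∈ 3ℤ²`** (`t > 0`): `Pt(t) ∩ Pt(3) ≠ ∅ ⟺ t = 3 * m ^ 2` —
commensurability one way, `Pt(3) ⊆ Pt(m²·3)` and `Pt(3) ≠ ∅` (`#(Pt(3)/Γ₆) = 2`) the other. [cite: KudlaRapoportYang2006, §3.4 Prop. 3.4.1, (3.4.6) and (3.4.9)] [cite: Ogg1983RealPoints, §2 (4)] [cite: BayerTravesa2007, §1 Thm. 1.1] -/
theorem exists_specialPoint_mem_three_iff {t : ℤ} (ht : 0 < t) :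
    (∃ τ : ℂ, 0 < τ.im ∧ (∃ x : ℍ[ℚ,((-1 : ℤ) : ℚ),((3 : ℤ) : ℚ)], x ∈ order (-1) 3 ∧ x.re = 0 ∧ (x * star x).re = t ∧
        moebius (rho (-1) 3 (by norm_num) (castQ (-1) 3 x)) τ = τ) ∧
      (∃ y : ℍ[ℚ,((-1 : ℤ) : ℚ),((3 : ℤ) : ℚ)], y ∈ order (-1) 3 ∧ y.re = 0 ∧ (y * star y).re = 3 ∧
        moebius (rho (-1) 3 (by norm_num) (castQ (-1) 3 y)) τ = τ)) ↔
    ∃ m : ℤ, t = 3 * m ^ 2 := by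
  constructor
  · rintro ⟨τ, hτ, ⟨x, -, hxre, hxn, hfx⟩, ⟨y, -, hyre, hyn, hfy⟩⟩
    exact exists_eq_three_mul_sq_of_specialPoints_inter_three hτ.ne' hxre hyre hxn hyn hfx hfy
  · rintro ⟨m, hm⟩
    have hm0 : m ≠ 0 := by rintro rfl; rw [hm] at ht; norm_num at ht
    obtain ⟨τ, hτ, hy⟩ := exists_point₁₉ 3 (by rw [card_specialPoints_table.2.1]; norm_num)
    exact ⟨τ, hτ, mem_of_sq_mul₁₉ hm0 (by rw [hm, mul_comm]) hy, by push_cast at hy; exact hy⟩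

/-- **`Z(t)` PASSES THROUGH THE `Z(6)`-POINTS IFF `t ∈ 6ℤ²`** (`t > 0`): `Pt(t) ∩ Pt(6) ≠ ∅ ⟺ t = 6 * m ^ 2` —
commensurability one way, `Pt(6) ⊆ Pt(m²·6)` and `Pt(6) ≠ ∅` (`#(Pt(6)/Γ₆) = 2`) the other. [cite: KudlaRapoportYang2006, §3.4 Prop. 3.4.1, (3.4.6) and (3.4.9)] [cite: Ogg1983RealPoints, §2 (4)] [cite: BayerTravesa2007, §1 Thm. 1.1] -/
theorem exists_specialPoint_mem_six_iff {t : ℤ} (ht : 0 < t) :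
    (∃ τ : ℂ, 0 < τ.im ∧ (∃ x : ℍ[ℚ,((-1 : ℤ) : ℚ),((3 : ℤ) : ℚ)], x ∈ order (-1) 3 ∧ x.re = 0 ∧ (x * star x).re = t ∧
        moebius (rho (-1) 3 (by norm_num) (castQ (-1) 3 x)) τ = τ) ∧
      (∃ y : ℍ[ℚ,((-1 : ℤ) : ℚ),((3 : ℤ) : ℚ)], y ∈ order (-1) 3 ∧ y.re = 0 ∧ (y * star y).re = 6 ∧
        moebius (rho (-1) 3 (by norm_num) (castQ (-1) 3 y)) τ = τ)) ↔
    ∃ m : ℤ, t = 6 * m ^ 2 := by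
  constructor
  · rintro ⟨τ, hτ, ⟨x, -, hxre, hxn, hfx⟩, ⟨y, -, hyre, hyn, hfy⟩⟩
    exact exists_eq_six_mul_sq_of_specialPoints_inter_six hτ.ne' hxre hyre hxn hyn hfx hfy
  · rintro ⟨m, hm⟩
    have hm0 : m ≠ 0 := by rintro rfl; rw [hm] at ht; norm_num at ht
    obtain ⟨τ, hτ, hy⟩ := exists_point₁₉ 6 (by rw [card_specialPoints_table.2.2.1]; norm_num)
    exact ⟨τ, hτ, mem_of_sq_mul₁₉ hm0 (by rw [hm, mul_comm]) hy, by push_cast at hy; exact hy⟩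

end Through

/-! ## §2 The elliptic points of `X₆` on `Z(t)`: `Z(1) ∪ Z(3)` -/

section XSix

/-- **A POINT OF `Pt(t)` IS ELLIPTIC FOR `Γ₆` IFF IT LIES ON `Z(1) ∪ Z(3)`**: an elliptic `u ∈ Γ₆ = O₆¹` (`u ≠ ±1`)
fixing `τ` is a special vector of norm `1` (order `2`) or `±(1 + x)/2` with `x ∈ L(3)` fixing `τ` (order `3`), and
conversely such vectors give elliptic elements. [cite: VignerasLNM800, Ch. IV §3 A (`e₂ = e₃ = 2` for `D = 6`)] [cite: BayerTravesa2007, §1 Thm. 1.1] [cite: KudlaRapoportYang2006, §3.4 (3.4.9)] -/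
theorem elliptic_iff_mem_one_or_three {t : ℤ} (p : {τ : ℂ // 0 < τ.im ∧ ∃ x : ℍ[ℚ,((-1 : ℤ) : ℚ),((3 : ℤ) : ℚ)],
        x ∈ order (-1) 3 ∧ x.re = 0 ∧ (x * star x).re = t ∧ moebius (rho (-1) 3 (by norm_num) (castQ (-1) 3 x)) τ = τ}) :
    (∃ u : ℍ[ℚ,((-1 : ℤ) : ℚ),((3 : ℤ) : ℚ)], (u ∈ order (-1) 3 ∨ u - ⟨1/2, 1/2, 1/2, -1/2⟩ ∈ order (-1) 3) ∧ u * star u = 1 ∧ u ≠ 1 ∧ u ≠ -1 ∧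
        moebius (rho (-1) 3 (by norm_num) (castQ (-1) 3 u)) p.1 = p.1) ↔
    (∃ y : ℍ[ℚ,((-1 : ℤ) : ℚ),((3 : ℤ) : ℚ)], y ∈ order (-1) 3 ∧ y.re = 0 ∧ (y * star y).re = 1 ∧
        moebius (rho (-1) 3 (by norm_num) (castQ (-1) 3 y)) p.1 = p.1) ∨
    (∃ y : ℍ[ℚ,((-1 : ℤ) : ℚ),((3 : ℤ) : ℚ)], y ∈ order (-1) 3 ∧ y.re = 0 ∧ (y * star y).re = 3 ∧
        moebius (rho (-1) 3 (by norm_num) (castQ (-1) 3 y)) p.1 = p.1) := by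
  constructor
  · rintro ⟨u, hu, hu1, h1, h1', hfix⟩
    rcases maxOrder_unit_moebius_eq_trichotomy hu hu1 h1 h1' p.2.1.ne' hfix with
      ⟨huo, hure, hun, -⟩ | ⟨x, hx, hxre, hxn, -, -, -, hxfix⟩ | ⟨x, hx, hxre, hxn, -, -, -, hxfix⟩
    · exact Or.inl ⟨u, huo, hure, hun, hfix⟩
    · exact Or.inr ⟨x, hx, hxre, hxn, hxfix⟩
    · exact Or.inr ⟨x, hx, hxre, hxn, hxfix⟩
  · rintro (⟨y, hy, hyre, hyn, hfy⟩ | ⟨y, hy, hyre, hyn, hfy⟩)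
    · refine ⟨y, Or.inl hy, mul_star_eq_one_of_re hyn, ?_, ?_, hfy⟩
      · intro h; have := congrArg QuaternionAlgebra.re h; rw [hyre, QuaternionAlgebra.re_one] at this; norm_num at this
      · intro h; have := congrArg QuaternionAlgebra.re h
        rw [hyre, QuaternionAlgebra.re_neg, QuaternionAlgebra.re_one] at this; norm_num at this
    · obtain ⟨hu, -, hu1, -, h1, h1', hfix⟩ := specialThree_fixedPoint_elliptic_order_three hy hyre hyn p.2.1.ne' hfy
      exact ⟨_, hu, hu1, h1, h1', hfix⟩

/-- **`Z(t)` PASSES THROUGH AN ELLIPTIC POINT OF `X₆` IFF `t ∈ ℤ² ∪ 3ℤ²`** (`t > 0`): through `P₆, P₁₃₅` (order `2`,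
the `Z(1)`-points) iff `t` is a square, through `P₂, P₄` (order `3`, the `Z(3)`-points) iff `t ∈ 3ℤ²`. [cite: BayerTravesa2007, §1 Thm. 1.1] [cite: VignerasLNM800, Ch. IV §3 A] [cite: KudlaRapoportYang2006, §3.4 Prop. 3.4.1 and (3.4.6)] -/
theorem exists_specialPoint_elliptic_iff {t : ℤ} (ht : 0 < t) :
    (∃ τ : ℂ, 0 < τ.im ∧ (∃ x : ℍ[ℚ,((-1 : ℤ) : ℚ),((3 : ℤ) : ℚ)], x ∈ order (-1) 3 ∧ x.re = 0 ∧ (x * star x).re = t ∧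
        moebius (rho (-1) 3 (by norm_num) (castQ (-1) 3 x)) τ = τ) ∧
      (∃ u : ℍ[ℚ,((-1 : ℤ) : ℚ),((3 : ℤ) : ℚ)], (u ∈ order (-1) 3 ∨ u - ⟨1/2, 1/2, 1/2, -1/2⟩ ∈ order (-1) 3) ∧ u * star u = 1 ∧ u ≠ 1 ∧ u ≠ -1 ∧
        moebius (rho (-1) 3 (by norm_num) (castQ (-1) 3 u)) τ = τ)) ↔
    ∃ m : ℤ, t = m ^ 2 ∨ t = 3 * m ^ 2 := by
  constructor
  · rintro ⟨τ, hτ, hmem, hell⟩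
    obtain ⟨x, -, hxre, hxn, hfx⟩ := id hmem
    rcases (elliptic_iff_mem_one_or_three (t := t) ⟨τ, hτ, hmem⟩).1 hell with
      ⟨y, -, hyre, hyn, hfy⟩ | ⟨y, -, hyre, hyn, hfy⟩
    · obtain ⟨m, hm⟩ := exists_eq_sq_of_specialPoints_inter_one hτ.ne' hxre hyre hxn hyn hfx hfy
      exact ⟨m, Or.inl hm⟩
    · obtain ⟨m, hm⟩ := exists_eq_three_mul_sq_of_specialPoints_inter_three hτ.ne' hxre hyre hxn hyn hfx hfy
      exact ⟨m, Or.inr hm⟩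
  · rintro ⟨m, hm | hm⟩
    · obtain ⟨τ, hτ, hmem, h1⟩ := (exists_specialPoint_mem_one_iff ht).2 ⟨m, hm⟩
      exact ⟨τ, hτ, hmem, (elliptic_iff_mem_one_or_three (t := t) ⟨τ, hτ, hmem⟩).2 (Or.inl h1)⟩
    · obtain ⟨τ, hτ, hmem, h3⟩ := (exists_specialPoint_mem_three_iff ht).2 ⟨m, hm⟩
      exact ⟨τ, hτ, hmem, (elliptic_iff_mem_one_or_three (t := t) ⟨τ, hτ, hmem⟩).2 (Or.inr h3)⟩

/-- **THE `W`-ORBIT OF AN ELLIPTIC POINT OF `X₆` ON `Z(t)` IS SHORT**: the fibre of `Pt(t)/Γ₆ → Pt(t)/Γ₆⁺` through a point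
fixed by an elliptic element of `Γ₆` has two classes (`ω₂` fixes the `Z(1)`-points, `ω₃` the `Z(3)`-points). [cite: Ogg1983RealPoints, §2 p. 284 and (4)] [cite: BayerTravesa2007, §1 Thm. 1.1 and §7 Table 9] -/
theorem card_fibre_eq_two_of_elliptic {t : ℤ} (p : {τ : ℂ // 0 < τ.im ∧ ∃ x : ℍ[ℚ,((-1 : ℤ) : ℚ),((3 : ℤ) : ℚ)],
        x ∈ order (-1) 3 ∧ x.re = 0 ∧ (x * star x).re = t ∧ moebius (rho (-1) 3 (by norm_num) (castQ (-1) 3 x)) τ = τ})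
    (h : ∃ u : ℍ[ℚ,((-1 : ℤ) : ℚ),((3 : ℤ) : ℚ)], (u ∈ order (-1) 3 ∨ u - ⟨1/2, 1/2, 1/2, -1/2⟩ ∈ order (-1) 3) ∧ u * star u = 1 ∧ u ≠ 1 ∧ u ≠ -1 ∧
        moebius (rho (-1) 3 (by norm_num) (castQ (-1) 3 u)) p.1 = p.1) :
    Nat.card {a : Quot (fun p q : {τ : ℂ // 0 < τ.im ∧ ∃ x : ℍ[ℚ,((-1 : ℤ) : ℚ),((3 : ℤ) : ℚ)],
        x ∈ order (-1) 3 ∧ x.re = 0 ∧ (x * star x).re = t ∧ moebius (rho (-1) 3 (by norm_num) (castQ (-1) 3 x)) τ = τ} ↦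
      ∃ v : ℍ[ℚ,((-1 : ℤ) : ℚ),((3 : ℤ) : ℚ)], (v ∈ order (-1) 3 ∨ v - ⟨1/2, 1/2, 1/2, -1/2⟩ ∈ order (-1) 3) ∧
        v * star v = 1 ∧ moebius (rho (-1) 3 (by norm_num) (castQ (-1) 3 v)) p.1 = q.1) //
      Quot.factor
      (fun p q : {τ : ℂ // 0 < τ.im ∧ ∃ x : ℍ[ℚ,((-1 : ℤ) : ℚ),((3 : ℤ) : ℚ)],
        x ∈ order (-1) 3 ∧ x.re = 0 ∧ (x * star x).re = t ∧ moebius (rho (-1) 3 (by norm_num) (castQ (-1) 3 x)) τ = τ} ↦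
        ∃ v : ℍ[ℚ,((-1 : ℤ) : ℚ),((3 : ℤ) : ℚ)], (v ∈ order (-1) 3 ∨ v - ⟨1/2, 1/2, 1/2, -1/2⟩ ∈ order (-1) 3) ∧
        v * star v = 1 ∧ moebius (rho (-1) 3 (by norm_num) (castQ (-1) 3 v)) p.1 = q.1)
      (fun p q : {τ : ℂ // 0 < τ.im ∧ ∃ x : ℍ[ℚ,((-1 : ℤ) : ℚ),((3 : ℤ) : ℚ)],
        x ∈ order (-1) 3 ∧ x.re = 0 ∧ (x * star x).re = t ∧ moebius (rho (-1) 3 (by norm_num) (castQ (-1) 3 x)) τ = τ} ↦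
        ∃ g : ℍ[ℚ,((-1 : ℤ) : ℚ),((3 : ℤ) : ℚ)], g ≠ 0 ∧
        (∀ a : ℍ[ℚ,((-1 : ℤ) : ℚ),((3 : ℤ) : ℚ)], (a ∈ order (-1) 3 ∨ a - ⟨1/2, 1/2, 1/2, -1/2⟩ ∈ order (-1) 3) →
          ∃ b : ℍ[ℚ,((-1 : ℤ) : ℚ),((3 : ℤ) : ℚ)], (b ∈ order (-1) 3 ∨ b - ⟨1/2, 1/2, 1/2, -1/2⟩ ∈ order (-1) 3) ∧
            g * a = b * g) ∧
        0 < (g * star g).re ∧ moebius (rho (-1) 3 (by norm_num) (castQ (-1) 3 g)) p.1 = q.1)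
      (specialPointsPlus_rel_of_specialPoints_rel t) a = Quot.mk _ p} = 2 := by
  rcases (elliptic_iff_mem_one_or_three p).1 h with h1 | h3
  · exact card_fibre_eq_two_of_mem_one p h1
  · exact card_fibre_eq_two_of_mem_three p h3

end XSix

/-! ## §3 The elliptic points of `X₆⁺` on `Z(t)`: `Z(1) ∪ Z(3) ∪ Z(6)`, the short `W`-orbits -/

section XSixPlus

/-- **A POINT OF `Pt(t)` IS ELLIPTIC FOR `Γ₆⁺` IFF IT LIES ON `Z(1) ∪ Z(3) ∪ Z(6)`**: a non-scalar `g ∈ Γ₆⁺` fixing `τ`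
normalises to `h ∈ O₆` of norm `d ∈ {1, 2, 3, 6}` fixing `τ`, whence a special vector of norm `1`, `3` or `6` fixing `τ`
(`normaliser_pos_fixed_special`); conversely that special vector is itself a non-scalar element of `Γ₆⁺`.
[cite: Ogg1983RealPoints, §2 p. 284 («`μ² = −m`», «`ε = 1 + ζ₄`, if `m = 2`, and `ε = 1 − ζ₃` if `m = 3`») and (4)] [cite: BayerTravesa2007, §2 and §7 Table 9] [cite: VignerasLNM800, Ch. IV §3 B] -/
theorem plusElliptic_iff_mem_one_three_six {t : ℤ} (p : {τ : ℂ // 0 < τ.im ∧ ∃ x : ℍ[ℚ,((-1 : ℤ) : ℚ),((3 : ℤ) : ℚ)],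
        x ∈ order (-1) 3 ∧ x.re = 0 ∧ (x * star x).re = t ∧ moebius (rho (-1) 3 (by norm_num) (castQ (-1) 3 x)) τ = τ}) :
    (∃ g : ℍ[ℚ,((-1 : ℤ) : ℚ),((3 : ℤ) : ℚ)], g ≠ 0 ∧
        (∀ a : ℍ[ℚ,((-1 : ℤ) : ℚ),((3 : ℤ) : ℚ)], (a ∈ order (-1) 3 ∨ a - ⟨1/2, 1/2, 1/2, -1/2⟩ ∈ order (-1) 3) →
          ∃ b : ℍ[ℚ,((-1 : ℤ) : ℚ),((3 : ℤ) : ℚ)], (b ∈ order (-1) 3 ∨ b - ⟨1/2, 1/2, 1/2, -1/2⟩ ∈ order (-1) 3) ∧ g * a = b * g) ∧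
        0 < (g * star g).re ∧ (∀ q : ℚ, g ≠ (q : ℍ[ℚ,((-1 : ℤ) : ℚ),((3 : ℤ) : ℚ)])) ∧
        moebius (rho (-1) 3 (by norm_num) (castQ (-1) 3 g)) p.1 = p.1) ↔
    (∃ y : ℍ[ℚ,((-1 : ℤ) : ℚ),((3 : ℤ) : ℚ)], y ∈ order (-1) 3 ∧ y.re = 0 ∧ (y * star y).re = 1 ∧
        moebius (rho (-1) 3 (by norm_num) (castQ (-1) 3 y)) p.1 = p.1) ∨
    (∃ y : ℍ[ℚ,((-1 : ℤ) : ℚ),((3 : ℤ) : ℚ)], y ∈ order (-1) 3 ∧ y.re = 0 ∧ (y * star y).re = 3 ∧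
        moebius (rho (-1) 3 (by norm_num) (castQ (-1) 3 y)) p.1 = p.1) ∨
    (∃ y : ℍ[ℚ,((-1 : ℤ) : ℚ),((3 : ℤ) : ℚ)], y ∈ order (-1) 3 ∧ y.re = 0 ∧ (y * star y).re = 6 ∧
        moebius (rho (-1) 3 (by norm_num) (castQ (-1) 3 y)) p.1 = p.1) := by
  constructor
  · rintro ⟨g, hg0, hL, hpos, hns, hfix⟩
    obtain ⟨q, v, k, l, -, hv, h1, -, -, hg⟩ := (normalises_maxOrder_iff_exists' hg0).1 hL
    have hR := (normalises_of_eq_smul_unit_mul_atkinLehner hv h1 k l hg).2.2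
    obtain ⟨x, hx, hre, hn, hfx⟩ := normaliser_pos_fixed_special hg0 hR hpos hns p.2.1.ne' hfix
    rcases hn with hn | hn | hn
    · exact Or.inl ⟨x, hx, hre, hn, hfx⟩
    · exact Or.inr (Or.inl ⟨x, hx, hre, hn, hfx⟩)
    · exact Or.inr (Or.inr ⟨x, hx, hre, hn, hfx⟩)
  · rintro (⟨y, hy, hyre, hyn, hfy⟩ | ⟨y, hy, hyre, hyn, hfy⟩ | ⟨y, hy, hyre, hyn, hfy⟩)
    · exact plusElliptic_of_special₁₉ (t₀ := 1) (Or.inl rfl) hy hyre (by rw [hyn]; norm_num) hfy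
    · exact plusElliptic_of_special₁₉ (t₀ := 3) (Or.inr (Or.inl rfl)) hy hyre (by rw [hyn]; norm_num) hfy
    · exact plusElliptic_of_special₁₉ (t₀ := 6) (Or.inr (Or.inr rfl)) hy hyre (by rw [hyn]; norm_num) hfy

/-- **`Z(t)` PASSES THROUGH AN ELLIPTIC POINT OF `X₆⁺` IFF `t ∈ ℤ² ∪ 3ℤ² ∪ 6ℤ²`** (`t > 0`): through the order-`4`
vertex `P₆` iff `t ∈ ℤ²`, the order-`6` vertex `P₄` iff `t ∈ 3ℤ²`, the order-`2` vertex `P₀` iff `t ∈ 6ℤ²` (§1).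
[cite: BayerTravesa2007, §7 Table 9 and §2] [cite: Ogg1983RealPoints, §2 (2)–(4)] [cite: KudlaRapoportYang2006, §3.4 Prop. 3.4.1, (3.4.6) and Remark 3.4.7] -/
theorem exists_specialPoint_plusElliptic_iff {t : ℤ} (ht : 0 < t) :
    (∃ τ : ℂ, 0 < τ.im ∧ (∃ x : ℍ[ℚ,((-1 : ℤ) : ℚ),((3 : ℤ) : ℚ)], x ∈ order (-1) 3 ∧ x.re = 0 ∧ (x * star x).re = t ∧
        moebius (rho (-1) 3 (by norm_num) (castQ (-1) 3 x)) τ = τ) ∧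
      (∃ g : ℍ[ℚ,((-1 : ℤ) : ℚ),((3 : ℤ) : ℚ)], g ≠ 0 ∧
        (∀ a : ℍ[ℚ,((-1 : ℤ) : ℚ),((3 : ℤ) : ℚ)], (a ∈ order (-1) 3 ∨ a - ⟨1/2, 1/2, 1/2, -1/2⟩ ∈ order (-1) 3) →
          ∃ b : ℍ[ℚ,((-1 : ℤ) : ℚ),((3 : ℤ) : ℚ)], (b ∈ order (-1) 3 ∨ b - ⟨1/2, 1/2, 1/2, -1/2⟩ ∈ order (-1) 3) ∧ g * a = b * g) ∧
        0 < (g * star g).re ∧ (∀ q : ℚ, g ≠ (q : ℍ[ℚ,((-1 : ℤ) : ℚ),((3 : ℤ) : ℚ)])) ∧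
        moebius (rho (-1) 3 (by norm_num) (castQ (-1) 3 g)) τ = τ)) ↔
    ∃ m : ℤ, t = m ^ 2 ∨ t = 3 * m ^ 2 ∨ t = 6 * m ^ 2 := by
  constructor
  · rintro ⟨τ, hτ, hmem, hell⟩
    obtain ⟨x, -, hxre, hxn, hfx⟩ := id hmem
    rcases (plusElliptic_iff_mem_one_three_six (t := t) ⟨τ, hτ, hmem⟩).1 hell with
      ⟨y, -, hyre, hyn, hfy⟩ | ⟨y, -, hyre, hyn, hfy⟩ | ⟨y, -, hyre, hyn, hfy⟩
    · obtain ⟨m, hm⟩ := exists_eq_sq_of_specialPoints_inter_one hτ.ne' hxre hyre hxn hyn hfx hfy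
      exact ⟨m, Or.inl hm⟩
    · obtain ⟨m, hm⟩ := exists_eq_three_mul_sq_of_specialPoints_inter_three hτ.ne' hxre hyre hxn hyn hfx hfy
      exact ⟨m, Or.inr (Or.inl hm)⟩
    · obtain ⟨m, hm⟩ := exists_eq_six_mul_sq_of_specialPoints_inter_six hτ.ne' hxre hyre hxn hyn hfx hfy
      exact ⟨m, Or.inr (Or.inr hm)⟩
  · rintro ⟨m, hm | hm | hm⟩
    · obtain ⟨τ, hτ, hmem, h1⟩ := (exists_specialPoint_mem_one_iff ht).2 ⟨m, hm⟩
      exact ⟨τ, hτ, hmem, (plusElliptic_iff_mem_one_three_six (t := t) ⟨τ, hτ, hmem⟩).2 (Or.inl h1)⟩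
    · obtain ⟨τ, hτ, hmem, h3⟩ := (exists_specialPoint_mem_three_iff ht).2 ⟨m, hm⟩
      exact ⟨τ, hτ, hmem, (plusElliptic_iff_mem_one_three_six (t := t) ⟨τ, hτ, hmem⟩).2 (Or.inr (Or.inl h3))⟩
    · obtain ⟨τ, hτ, hmem, h6⟩ := (exists_specialPoint_mem_six_iff ht).2 ⟨m, hm⟩
      exact ⟨τ, hτ, hmem, (plusElliptic_iff_mem_one_three_six (t := t) ⟨τ, hτ, hmem⟩).2 (Or.inr (Or.inr h6))⟩

/-- **THE SHORT `W`-ORBITS OF `Z(t)` ARE EXACTLY THE FIBRES OVER THE ELLIPTIC POINTS OF `X₆⁺`**: a fibre of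
`Pt(t)/Γ₆ → Pt(t)/Γ₆⁺` has two classes iff its points are fixed by a non-scalar element of `Γ₆⁺` — the ramification of
`Z(t) ⊂ X₆ → X₆⁺`. [cite: KudlaRapoportYang2006, §3.4 Remark 3.4.7] [cite: Ogg1983RealPoints, §2 (2)–(4)] [cite: BayerTravesa2007, §2 and §7 Table 9] [cite: VignerasLNM800, Ch. IV §3 B] -/
theorem card_fibre_eq_two_iff_plusElliptic {t : ℤ} (p : {τ : ℂ // 0 < τ.im ∧ ∃ x : ℍ[ℚ,((-1 : ℤ) : ℚ),((3 : ℤ) : ℚ)],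
        x ∈ order (-1) 3 ∧ x.re = 0 ∧ (x * star x).re = t ∧ moebius (rho (-1) 3 (by norm_num) (castQ (-1) 3 x)) τ = τ}) :
    Nat.card {a : Quot (fun p q : {τ : ℂ // 0 < τ.im ∧ ∃ x : ℍ[ℚ,((-1 : ℤ) : ℚ),((3 : ℤ) : ℚ)],
        x ∈ order (-1) 3 ∧ x.re = 0 ∧ (x * star x).re = t ∧ moebius (rho (-1) 3 (by norm_num) (castQ (-1) 3 x)) τ = τ} ↦
      ∃ v : ℍ[ℚ,((-1 : ℤ) : ℚ),((3 : ℤ) : ℚ)], (v ∈ order (-1) 3 ∨ v - ⟨1/2, 1/2, 1/2, -1/2⟩ ∈ order (-1) 3) ∧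
        v * star v = 1 ∧ moebius (rho (-1) 3 (by norm_num) (castQ (-1) 3 v)) p.1 = q.1) //
      Quot.factor
      (fun p q : {τ : ℂ // 0 < τ.im ∧ ∃ x : ℍ[ℚ,((-1 : ℤ) : ℚ),((3 : ℤ) : ℚ)],
        x ∈ order (-1) 3 ∧ x.re = 0 ∧ (x * star x).re = t ∧ moebius (rho (-1) 3 (by norm_num) (castQ (-1) 3 x)) τ = τ} ↦
        ∃ v : ℍ[ℚ,((-1 : ℤ) : ℚ),((3 : ℤ) : ℚ)], (v ∈ order (-1) 3 ∨ v - ⟨1/2, 1/2, 1/2, -1/2⟩ ∈ order (-1) 3) ∧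
        v * star v = 1 ∧ moebius (rho (-1) 3 (by norm_num) (castQ (-1) 3 v)) p.1 = q.1)
      (fun p q : {τ : ℂ // 0 < τ.im ∧ ∃ x : ℍ[ℚ,((-1 : ℤ) : ℚ),((3 : ℤ) : ℚ)],
        x ∈ order (-1) 3 ∧ x.re = 0 ∧ (x * star x).re = t ∧ moebius (rho (-1) 3 (by norm_num) (castQ (-1) 3 x)) τ = τ} ↦
        ∃ g : ℍ[ℚ,((-1 : ℤ) : ℚ),((3 : ℤ) : ℚ)], g ≠ 0 ∧
        (∀ a : ℍ[ℚ,((-1 : ℤ) : ℚ),((3 : ℤ) : ℚ)], (a ∈ order (-1) 3 ∨ a - ⟨1/2, 1/2, 1/2, -1/2⟩ ∈ order (-1) 3) →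
          ∃ b : ℍ[ℚ,((-1 : ℤ) : ℚ),((3 : ℤ) : ℚ)], (b ∈ order (-1) 3 ∨ b - ⟨1/2, 1/2, 1/2, -1/2⟩ ∈ order (-1) 3) ∧
            g * a = b * g) ∧
        0 < (g * star g).re ∧ moebius (rho (-1) 3 (by norm_num) (castQ (-1) 3 g)) p.1 = q.1)
      (specialPointsPlus_rel_of_specialPoints_rel t) a = Quot.mk _ p} = 2 ↔
    ∃ g : ℍ[ℚ,((-1 : ℤ) : ℚ),((3 : ℤ) : ℚ)], g ≠ 0 ∧
        (∀ a : ℍ[ℚ,((-1 : ℤ) : ℚ),((3 : ℤ) : ℚ)], (a ∈ order (-1) 3 ∨ a - ⟨1/2, 1/2, 1/2, -1/2⟩ ∈ order (-1) 3) →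
          ∃ b : ℍ[ℚ,((-1 : ℤ) : ℚ),((3 : ℤ) : ℚ)], (b ∈ order (-1) 3 ∨ b - ⟨1/2, 1/2, 1/2, -1/2⟩ ∈ order (-1) 3) ∧ g * a = b * g) ∧
        0 < (g * star g).re ∧ (∀ q : ℚ, g ≠ (q : ℍ[ℚ,((-1 : ℤ) : ℚ),((3 : ℤ) : ℚ)])) ∧
        moebius (rho (-1) 3 (by norm_num) (castQ (-1) 3 g)) p.1 = p.1 := by
  rw [card_fibre_eq_two_iff p, plusElliptic_iff_mem_one_three_six p]

/-- **… AND THE FULL `W`-ORBITS ARE THE FIBRES OVER THE NON-ELLIPTIC POINTS OF `X₆⁺`**: four classes iff no non-scalar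
element of `Γ₆⁺` fixes the point. [cite: KudlaRapoportYang2006, §3.4 Remark 3.4.7] [cite: Ogg1983RealPoints, §2 (2)–(4)] [cite: BayerTravesa2007, §2] -/
theorem card_fibre_eq_four_iff_not_plusElliptic {t : ℤ} (p : {τ : ℂ // 0 < τ.im ∧ ∃ x : ℍ[ℚ,((-1 : ℤ) : ℚ),((3 : ℤ) : ℚ)],
        x ∈ order (-1) 3 ∧ x.re = 0 ∧ (x * star x).re = t ∧ moebius (rho (-1) 3 (by norm_num) (castQ (-1) 3 x)) τ = τ}) :
    Nat.card {a : Quot (fun p q : {τ : ℂ // 0 < τ.im ∧ ∃ x : ℍ[ℚ,((-1 : ℤ) : ℚ),((3 : ℤ) : ℚ)],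
        x ∈ order (-1) 3 ∧ x.re = 0 ∧ (x * star x).re = t ∧ moebius (rho (-1) 3 (by norm_num) (castQ (-1) 3 x)) τ = τ} ↦
      ∃ v : ℍ[ℚ,((-1 : ℤ) : ℚ),((3 : ℤ) : ℚ)], (v ∈ order (-1) 3 ∨ v - ⟨1/2, 1/2, 1/2, -1/2⟩ ∈ order (-1) 3) ∧
        v * star v = 1 ∧ moebius (rho (-1) 3 (by norm_num) (castQ (-1) 3 v)) p.1 = q.1) //
      Quot.factor
      (fun p q : {τ : ℂ // 0 < τ.im ∧ ∃ x : ℍ[ℚ,((-1 : ℤ) : ℚ),((3 : ℤ) : ℚ)],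
        x ∈ order (-1) 3 ∧ x.re = 0 ∧ (x * star x).re = t ∧ moebius (rho (-1) 3 (by norm_num) (castQ (-1) 3 x)) τ = τ} ↦
        ∃ v : ℍ[ℚ,((-1 : ℤ) : ℚ),((3 : ℤ) : ℚ)], (v ∈ order (-1) 3 ∨ v - ⟨1/2, 1/2, 1/2, -1/2⟩ ∈ order (-1) 3) ∧
        v * star v = 1 ∧ moebius (rho (-1) 3 (by norm_num) (castQ (-1) 3 v)) p.1 = q.1)
      (fun p q : {τ : ℂ // 0 < τ.im ∧ ∃ x : ℍ[ℚ,((-1 : ℤ) : ℚ),((3 : ℤ) : ℚ)],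
        x ∈ order (-1) 3 ∧ x.re = 0 ∧ (x * star x).re = t ∧ moebius (rho (-1) 3 (by norm_num) (castQ (-1) 3 x)) τ = τ} ↦
        ∃ g : ℍ[ℚ,((-1 : ℤ) : ℚ),((3 : ℤ) : ℚ)], g ≠ 0 ∧
        (∀ a : ℍ[ℚ,((-1 : ℤ) : ℚ),((3 : ℤ) : ℚ)], (a ∈ order (-1) 3 ∨ a - ⟨1/2, 1/2, 1/2, -1/2⟩ ∈ order (-1) 3) →
          ∃ b : ℍ[ℚ,((-1 : ℤ) : ℚ),((3 : ℤ) : ℚ)], (b ∈ order (-1) 3 ∨ b - ⟨1/2, 1/2, 1/2, -1/2⟩ ∈ order (-1) 3) ∧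
            g * a = b * g) ∧
        0 < (g * star g).re ∧ moebius (rho (-1) 3 (by norm_num) (castQ (-1) 3 g)) p.1 = q.1)
      (specialPointsPlus_rel_of_specialPoints_rel t) a = Quot.mk _ p} = 4 ↔
    ¬ (∃ g : ℍ[ℚ,((-1 : ℤ) : ℚ),((3 : ℤ) : ℚ)], g ≠ 0 ∧
        (∀ a : ℍ[ℚ,((-1 : ℤ) : ℚ),((3 : ℤ) : ℚ)], (a ∈ order (-1) 3 ∨ a - ⟨1/2, 1/2, 1/2, -1/2⟩ ∈ order (-1) 3) →
          ∃ b : ℍ[ℚ,((-1 : ℤ) : ℚ),((3 : ℤ) : ℚ)], (b ∈ order (-1) 3 ∨ b - ⟨1/2, 1/2, 1/2, -1/2⟩ ∈ order (-1) 3) ∧ g * a = b * g) ∧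
        0 < (g * star g).re ∧ (∀ q : ℚ, g ≠ (q : ℍ[ℚ,((-1 : ℤ) : ℚ),((3 : ℤ) : ℚ)])) ∧
        moebius (rho (-1) 3 (by norm_num) (castQ (-1) 3 g)) p.1 = p.1) := by
  rw [card_fibre_eq_four_iff p, plusElliptic_iff_mem_one_three_six p]

end XSixPlus

end Literature.Geometry.Kaehler.ComplexTorus.QuaternionType
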